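import Summits.CriticalPhenomena.CardyFormulaZ2.Theorems.CardyComplexConeParafermionToSLESixFamiliesDiamondTouchLowerLattice
import Summits.CriticalPhenomena.CardyFormulaZ2.Theorems.CardyComplexConeParafermionToSLESixFamiliesDiamondTouchLowerTransport
import HarnessLib

/-!
# The probability of the gluing events of the free-side touch bound, uniformly over the four frames
# (line `potential-darboux-picard-diamond`, S3 (c) `freeTouchLower_of_diagArmLower`, part 4)

Crux `ParafermionToSLESixFamilies` (stmt-CriticalPhenomena-11389), line `potential-darboux-picard-diamond`, conditional
helper `freeTouchLower_of_diagArmLower` of S3. The lattice events of `…TouchLowerLattice` (`armEv`, `uEv`, `vEv`,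
`crossEv`, `ringEv`, `connEv`, local notation) live in the four side frames `(layerFn (k+3), dp[n, k, ·])` of a diamond
discretisation, whose depth offsets `n k` vary with the mesh. Their probabilities are controlled with constants INDEPENDENT
of the frame and of `n`, by transporting each event along the lattice automorphisms `SR[k]` / `SI[k, x]` of
`…TouchLowerFrames` to the diagonal frame `(col, hgtOf)` of the tree (`…TouchLowerTransport`), where the tree's RSW inputs
`diag_rswLR/TB` and the Harris–FKG gluing `real_arm_glue_ge` apply once and for all:

* `real_site_glue_ge` — `c · P(armEv x 2m) · P(R) ≤ P(armEv ∩ uEv ∩ vEv ∩ R)` for every touch-row site `x` of every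
  side, every `m ≥ m₀` and every increasing measurable `R`;
* `real_armEv_eq`, `real_arm_std_ge` — `P(armEv x N) = P(arm[0, N])` and `P(arm[0, N]) ≥ ½ · π◇(N + 1)`, the diagonal
  half-plane one-arm probability of the crux line (`DiagHalfPlaneOneArmLower`'s event, `real_diagArm_eq`);
* `real_ringConn_ge` — `P(ringEv ∩ connEv) ≥ c(K) > 0` as soon as the strip width `w ≥ m₀` dominates the box up to the
  aspect ratio `K` (four long crossings and one short one, Harris–FKG).
-/

noncomputable section

namespace Summit.CriticalPhenomena.CardyFormulaZ2.Cruxes.ParafermionToSLESixFamilies.PotentialDarbouxPicardDiamond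

open MeasureTheory Set Complex
open Literature.Probability Literature.Probability.LatticeModels Literature.Probability.Percolation
open Literature.Probability.Percolation.TrackExchange (col hgtOf)
open Literature.Probability.Percolation.HalfPlaneArm (diag_X_le diag_Y_le diag_injective diag_rswLR diag_rswTB)

/-- The depth of `v` below the touch row of side `k` (last inside layer `n k`). -/
local notation3 "dp[" n ", " k ", " v "]" => (n : Fin 4 → ℤ) k - 2 - layerFn (k + 2) v

/-- The rotation of side `k`. -/
local notation3 "SR[" k "]" => (![zdSignedPermIso (Equiv.swap 0 1) ![-1, 1], zdSignedPermIso 1 (fun _ => -1),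
    zdSignedPermIso (Equiv.swap 0 1) ![1, -1], zdSignedPermIso 1 (fun _ => 1)] : Fin 4 → (zdGraph 2 ≃g zdGraph 2)) k

/-- The lattice automorphism based at the site `x` of side `k`. -/
local notation3 "SI[" k ", " x "]" => (zdShiftIso ((SR[k]).symm x)).trans SR[k]

/-- The angle of the drawing of side `k`. -/
local notation3 "SA[" k "]" => (![-(Real.pi / 2), Real.pi, Real.pi / 2, 0] : Fin 4 → ℝ) k

/-- The isoradial drawing of side `k`. -/
local notation3 "SE[" n ", " k "]" => (gmEmbedding (fun _ => SA[k]) (fun _ => SA[k] + Real.pi / 2)).translate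
    ((((n : Fin 4 → ℤ) k - 2 : ℤ) : ℂ) * I)

/-- The interior of the lattice box: depth `≥ 0` below all four touch rows. -/
local notation3 "boxI[" n "]" => {v : Site 2 | ∀ j : Fin 4, 0 ≤ dp[n, j, v]}

/-- The strip of depth `≤ w` along side `j`, inside the interior. -/
local notation3 "strip[" n ", " w ", " j "]" => {v : Site 2 | (∀ i : Fin 4, 0 ≤ dp[n, i, v]) ∧ dp[n, j, v] ≤ w}

/-- The touch row of side `j` (depth `0`). -/
local notation3 "face[" n ", " j "]" => {v : Site 2 | dp[n, j, v] = 0}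

/-- The crossing event of the strip of side `j` (the long way, from the touch row of side `j + 3` to that of `j + 1`). -/
local notation3 "crossEv[" n ", " w ", " j "]" => openCrossing strip[n, w, j] face[n, j + 3] face[n, j + 1]

/-- The ring event: all four strips are crossed the long way. -/
local notation3 "ringEv[" n ", " w "]" => ⋂ j : Fin 4, crossEv[n, w, j]

/-- The connector of side `k` at tangential position `lo`: the box `[lo, lo + w] × [−1, w]` of the frame of side `k`. -/
local notation3 "connQ[" n ", " w ", " k ", " lo "]" => {v : Site 2 | lo ≤ layerFn (k + 3) v ∧ layerFn (k + 3) v ≤ lo + w ∧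
    -1 ≤ dp[n, k, v] ∧ dp[n, k, v] ≤ w}

/-- The connector event: the connector is crossed from the boundary layer `dp = −1` to the depth `w`. -/
local notation3 "connEv[" n ", " w ", " k ", " lo "]" => openCrossing connQ[n, w, k, lo] {v : Site 2 | dp[n, k, v] = -1}
    {v : Site 2 | dp[n, k, v] = w}

/-- The arm event of the touch-row site `x` of side `k` to half-plane distance `N`. -/
local notation3 "armEv[" n ", " k ", " x ", " N "]" => openCrossing
    {v : Site 2 | 0 ≤ dp[n, k, v] ∧ max |layerFn (k + 3) v - layerFn (k + 3) x| (dp[n, k, v] - dp[n, k, x]) ≤ N} {x}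
    {v : Site 2 | max |layerFn (k + 3) v - layerFn (k + 3) x| (dp[n, k, v] - dp[n, k, x]) = N}

/-- The U event at scale `m` around the site `x` of side `k` (two pillars crossed across, one bar crossed along). -/
local notation3 "uEv[" n ", " k ", " x ", " m "]" =>
    openCrossing {v : Site 2 | layerFn (k + 3) x + m ≤ layerFn (k + 3) v ∧ layerFn (k + 3) v ≤ layerFn (k + 3) x + 2 * m ∧
        0 ≤ dp[n, k, v] ∧ dp[n, k, v] ≤ dp[n, k, x] + 2 * m} {v : Site 2 | dp[n, k, v] = 0}
        {v : Site 2 | dp[n, k, v] = dp[n, k, x] + 2 * m} ∩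
      openCrossing {v : Site 2 | layerFn (k + 3) x - 2 * m ≤ layerFn (k + 3) v ∧ layerFn (k + 3) v ≤ layerFn (k + 3) x + 2 * m ∧
        dp[n, k, x] + m ≤ dp[n, k, v] ∧ dp[n, k, v] ≤ dp[n, k, x] + 2 * m} {v : Site 2 | layerFn (k + 3) v = layerFn (k + 3) x - 2 * m}
        {v : Site 2 | layerFn (k + 3) v = layerFn (k + 3) x + 2 * m} ∩
      openCrossing {v : Site 2 | layerFn (k + 3) x - 2 * m ≤ layerFn (k + 3) v ∧ layerFn (k + 3) v ≤ layerFn (k + 3) x - m ∧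
        0 ≤ dp[n, k, v] ∧ dp[n, k, v] ≤ dp[n, k, x] + 2 * m} {v : Site 2 | dp[n, k, v] = 0}
        {v : Site 2 | dp[n, k, v] = dp[n, k, x] + 2 * m}

/-- The vertical connector event at `x`: the box `[tng x − m, tng x + m] × [0, 3m]` of side `k` is crossed across. -/
local notation3 "vEv[" n ", " k ", " x ", " m "]" => openCrossing
    {v : Site 2 | layerFn (k + 3) x - m ≤ layerFn (k + 3) v ∧ layerFn (k + 3) v ≤ layerFn (k + 3) x + m ∧ 0 ≤ dp[n, k, v] ∧
      dp[n, k, v] ≤ 3 * m} {v : Site 2 | dp[n, k, v] = 0} {v : Site 2 | dp[n, k, v] = 3 * m}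

/-! ## The arm, U and vertical connector of a touch-row site -/

/-- **Harris–FKG gluing at a touch-row site, uniformly over sides and offsets.** There are `c > 0` and `m₀` such that for
every depth datum `n`, side `k`, touch-row site `x` (`dp[n, k, x] = 0`), scale `m ≥ m₀` and increasing measurable event
`R`: `c · P(armEv[n, k, x, 2m]) · P(R) ≤ P(armEv[n, k, x, 2m] ∩ uEv[n, k, x, m] ∩ vEv[n, k, x, m] ∩ R)`. -/
theorem real_site_glue_ge : ∃ c : ℝ, 0 < c ∧ ∃ m₀ : ℕ, ∀ (n : Fin 4 → ℤ) (k : Fin 4) (x : Site 2), dp[n, k, x] = 0 →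
    ∀ m : ℤ, (m₀ : ℤ) ≤ m → ∀ R : Set (BondConfig (Site 2)), IsUpperSet R → MeasurableSet R →
      c * (bondPercolation (zdGraph 2) half).real armEv[n, k, x, 2 * m] * (bondPercolation (zdGraph 2) half).real R ≤
        (bondPercolation (zdGraph 2) half).real (armEv[n, k, x, 2 * m] ∩ uEv[n, k, x, m] ∩ vEv[n, k, x, m] ∩ R) := by
  obtain ⟨c, hc, m₀, h⟩ := TouchLower.real_arm_glue_transport (X := col) (Y := hgtOf) diag_X_le diag_Y_le diag_injective
    half diag_rswLR diag_rswTB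
  refine ⟨c, hc, m₀, fun n k x hx m hm R hR hRm => ?_⟩
  have hYφ : ∀ v, dp[n, k, SI[k, x] v] = hgtOf v := fun v => by rw [dp_siteIso, hx, add_zero]
  have key := h (layerFn (k + 3)) (fun v => dp[n, k, v]) SI[k, x] (col ((SR[k]).symm x)) (tng_siteIso k x) hYφ 0 m
    (by simp [hgtOf]) hm R hR hRm
  simp only [siteIso_zero] at key
  exact key

/-- **The arm event of a touch-row site has the probability of the standard diagonal arm** (transport along `SI[k, x]`). -/
theorem real_armEv_eq (n : Fin 4 → ℤ) (k : Fin 4) (x : Site 2) (hx : dp[n, k, x] = 0) (N : ℤ) :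
    (bondPercolation (zdGraph 2) half).real armEv[n, k, x, N] =
      (bondPercolation (zdGraph 2) half).real (openCrossing {v : Site 2 | 0 ≤ hgtOf v ∧ max |col v - col 0| (hgtOf v - hgtOf 0) ≤ N}
        {0} {v : Site 2 | max |col v - col 0| (hgtOf v - hgtOf 0) = N}) := by
  have hYφ : ∀ v, dp[n, k, SI[k, x] v] = hgtOf v := fun v => by rw [dp_siteIso, hx, add_zero]
  have key := TouchLower.real_arm_transport (X := col) (Y := hgtOf) (X' := layerFn (k + 3)) (Y' := fun v => dp[n, k, v])
    SI[k, x] (tng_siteIso k x) hYφ half 0 N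
  simp only [siteIso_zero] at key
  exact key

/-- **The standard diagonal arm from the boundary row dominates half the crux line's one-arm probability**: for
`N : ℕ`, `½ · π◇(N + 1) ≤ P(arm[0, N])`, where `π◇(n)` is the probability that the origin is joined inside the diagonal
half-box `{s ≤ 1, −n ≤ s, |d| ≤ n}` to its far sides (the event of `DiagHalfPlaneOneArmLower`): by `real_diagArm_eq` that
event is the arm from `(1, 0)` (depth `1`), and `real_arm_shift` moves the base point to the origin (depth `0`). -/
theorem real_arm_std_ge (N : ℕ) :
    1 / 2 * (bondPercolation (zdGraph 2) half).real
        {ω | ∃ y : Site 2, (y 0 + y 1 = -((N + 1 : ℕ) : ℤ) ∨ y 0 - y 1 = ((N + 1 : ℕ) : ℤ) ∨ y 0 - y 1 = -((N + 1 : ℕ) : ℤ)) ∧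
          ω ∈ openConnIn {v : Site 2 | v 0 + v 1 ≤ 1 ∧ -((N + 1 : ℕ) : ℤ) ≤ v 0 + v 1 ∧
            -((N + 1 : ℕ) : ℤ) ≤ v 0 - v 1 ∧ v 0 - v 1 ≤ ((N + 1 : ℕ) : ℤ)} 0 y} ≤
      (bondPercolation (zdGraph 2) half).real (openCrossing {v : Site 2 | 0 ≤ hgtOf v ∧ max |col v - col 0| (hgtOf v - hgtOf 0) ≤ N}
        {0} {v : Site 2 | max |col v - col 0| (hgtOf v - hgtOf 0) = N}) := by
  rw [Literature.Probability.Percolation.HalfPlaneArm.real_diagArm_eq (N + 1)]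
  have hadj : (zdGraph 2).Adj (0 : Site 2) ![1, 0] := by
    rw [zdGraph_adj_iff]
    exact ⟨0, Or.inl (by funext i; fin_cases i <;> simp)⟩
  have key := TouchLower.real_arm_shift (X := col) (Y := hgtOf) diag_X_le diag_Y_le diag_injective half hadj
    (by simp [hgtOf]) (by simp [col]) (by simp [hgtOf]) (n := ((N + 1 : ℕ) : ℤ)) (by push_cast; omega)
  rw [coe_half] at key
  push_cast at key
  rw [add_sub_cancel_right] at key
  exact key

/-! ## The ring and the connector -/

/-- The interior is finite. -/
theorem boxI_finite (n : Fin 4 → ℤ) : (boxI[n]).Finite := by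
  rw [boxI_eq n 0]
  exact HalfPlaneArm.box_finite (tng_dp_injective n 0) _ _ _ _

/-- The strips are finite. -/
theorem strip_finite (n : Fin 4 → ℤ) (w : ℤ) (j : Fin 4) : (strip[n, w, j]).Finite :=
  (boxI_finite n).subset fun _ hv => hv.1

/-- The connector is finite. -/
theorem connQ_finite (n : Fin 4 → ℤ) (w : ℤ) (k : Fin 4) (lo : ℤ) : (connQ[n, w, k, lo]).Finite :=
  HalfPlaneArm.box_finite (tng_dp_injective n k) _ _ _ _

/-- The strip crossing events are measurable. -/
theorem measurableSet_crossEv (n : Fin 4 → ℤ) (w : ℤ) (j : Fin 4) : MeasurableSet crossEv[n, w, j] :=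
  HalfPlaneArm.measurableSet_openCrossing_of_finite (strip_finite n w j) _ _

/-- The ring event is measurable. -/
theorem measurableSet_ringEv (n : Fin 4 → ℤ) (w : ℤ) : MeasurableSet ringEv[n, w] :=
  MeasurableSet.iInter fun j => measurableSet_crossEv n w j

/-- The ring event is increasing. -/
theorem isUpperSet_ringEv (n : Fin 4 → ℤ) (w : ℤ) : IsUpperSet ringEv[n, w] :=
  isUpperSet_iInter fun _ => isUpperSet_openCrossing _ _ _

/-- The connector event is measurable. -/
theorem measurableSet_connEv (n : Fin 4 → ℤ) (w : ℤ) (k : Fin 4) (lo : ℤ) : MeasurableSet connEv[n, w, k, lo] :=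
  HalfPlaneArm.measurableSet_openCrossing_of_finite (connQ_finite n w k lo) _ _

/-- The ring event as a fourfold intersection. -/
theorem ringEv_eq (n : Fin 4 → ℤ) (w : ℤ) : ringEv[n, w] = crossEv[n, w, 0] ∩ crossEv[n, w, 1] ∩ crossEv[n, w, 2] ∩ crossEv[n, w, 3] := by
  ext ω
  rw [mem_ringEv_iff n 0 w]
  simp only [zero_add, mem_inter_iff]
  tauto

/-- **The ring and the connector are likely.** For every aspect ratio `K` there are `c > 0` and `m₀` such that for every
depth datum `n`, strip width `w ≥ m₀` with `w ≤ n j + n (j+2) − 4 ≤ K w` for all `j`, side `k'` and position `lo`: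
`c ≤ P(ringEv[n, w] ∩ connEv[n, w, k', lo])` (four long crossings of `≤ K w × w` strips and one crossing of the
`w × (w + 1)` connector, transported to the diagonal frame, `lr_lower` / `tb_lower`, Harris–FKG). -/
theorem real_ringConn_ge (K : ℕ) : ∃ c : ℝ, 0 < c ∧ ∃ m₀ : ℕ, ∀ (n : Fin 4 → ℤ) (w : ℤ) (k' : Fin 4) (lo : ℤ),
    (m₀ : ℤ) ≤ w → (∀ j, w ≤ n j + n (j + 2) - 4) → (∀ j, n j + n (j + 2) - 4 ≤ K * w) →
    c ≤ (bondPercolation (zdGraph 2) half).real (ringEv[n, w] ∩ connEv[n, w, k', lo]) := by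
  obtain ⟨c₁, hc₁, m₁, h₁⟩ := HalfPlaneArm.lr_lower (X := col) (Y := hgtOf) diag_X_le half diag_rswLR K
  obtain ⟨c₂, hc₂, m₂, h₂⟩ := HalfPlaneArm.tb_lower (X := col) (Y := hgtOf) diag_Y_le half diag_rswTB 2
  refine ⟨c₁ * c₁ * c₁ * c₁ * c₂, by positivity, max m₁ m₂ + 1, fun n w k' lo hw₀ hw hK => ?_⟩
  set μ := bondPercolation (zdGraph 2) half with hμ
  have hm' : ((max m₁ m₂ + 1 : ℕ) : ℤ) = max (m₁ : ℤ) (m₂ : ℤ) + 1 := by push_cast; rfl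
  rw [hm'] at hw₀
  have hm₁ : (m₁ : ℤ) ≤ max (m₁ : ℤ) (m₂ : ℤ) := le_max_left _ _
  have hm₂ : (m₂ : ℤ) ≤ max (m₁ : ℤ) (m₂ : ℤ) := le_max_right _ _
  have hwpos : 0 ≤ w := by omega
  have hcast : ((w.toNat : ℕ) : ℤ) = w := Int.toNat_of_nonneg hwpos
  have hwm₁ : m₁ ≤ w.toNat := by
    have : ((m₁ : ℕ) : ℤ) ≤ (w.toNat : ℤ) := by rw [hcast]; omega
    exact_mod_cast this
  have hwm₂ : m₂ ≤ w.toNat := by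
    have : ((m₂ : ℕ) : ℤ) ≤ (w.toNat : ℤ) := by rw [hcast]; omega
    exact_mod_cast this
  -- each strip crossing
  have hcross : ∀ j, c₁ ≤ μ.real crossEv[n, w, j] := by
    intro j
    have hwidth := width_succ n j hw
    have hKj : n (j + 1) + n (j + 3) - 4 ≤ K * w := by have := hK (j + 1); rwa [fin4_add_one_add_two] at this
    rw [crossEv_self n j hw, hμ, TouchLower.real_LR_transport (X := col) (Y := hgtOf) SR[j] (tng_sideRot j)
      (dp_sideRot n j) half]
    have key := h₁ w.toNat hwm₁ (2 - n (j + 3) - 0) (0 - (n j - 2)) (n (j + 1) + n (j + 3) - 4) (by omega)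
      (by rw [hcast]; exact hKj)
    rw [hcast] at key
    convert key using 7 <;> ring_nf
  -- the connector crossing
  have hconn : c₂ ≤ μ.real connEv[n, w, k', lo] := by
    rw [hμ, TouchLower.real_TB_transport (X := col) (Y := hgtOf) SR[k'] (tng_sideRot k') (dp_sideRot n k') half]
    have key := h₂ w.toNat hwm₂ (lo - 0) (-1 - (n k' - 2)) (w + 1) (by omega) (by rw [hcast]; omega)
    rw [hcast] at key
    convert key using 7 <;> ring_nf
  -- Harris–FKG
  have mC := measurableSet_crossEv n w
  have uC : ∀ j, IsUpperSet crossEv[n, w, j] := fun j => isUpperSet_openCrossing _ _ _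
  have hH := HalfPlaneArm.harris₅ half (uC 0) (uC 1) (uC 2) (uC 3) (isUpperSet_openCrossing _ _ _) (mC 0) (mC 1) (mC 2)
    (mC 3) (measurableSet_connEv n w k' lo)
  rw [ringEv_eq]
  calc c₁ * c₁ * c₁ * c₁ * c₂ ≤ μ.real crossEv[n, w, 0] * μ.real crossEv[n, w, 1] * μ.real crossEv[n, w, 2] *
        μ.real crossEv[n, w, 3] * μ.real connEv[n, w, k', lo] := by
        have := hcross 0; have := hcross 1; have := hcross 2; have := hcross 3
        gcongr
    _ ≤ _ := hH

/-- **Registered form of `real_site_glue_ge` (helper of `freeTouchLower_of_diagArmLower`), notation-free.** -/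
theorem touchLower_real_site_glue_ge : ∃ c : ℝ, 0 < c ∧ ∃ m₀ : ℕ, ∀ (n : Fin 4 → ℤ) (k : Fin 4) (x : Site 2), n k - 2 - layerFn (k + 2) x = 0 → ∀ m : ℤ, (m₀ : ℤ) ≤ m → ∀ R : Set (BondConfig (Site 2)), IsUpperSet R → MeasurableSet R → c * (bondPercolation (zdGraph 2) half).real (openCrossing {v : Site 2 | 0 ≤ n k - 2 - layerFn (k + 2) v ∧ max |layerFn (k + 3) v - layerFn (k + 3) x| (n k - 2 - layerFn (k + 2) v - (n k - 2 - layerFn (k + 2) x)) ≤ 2 * m} {x} {v : Site 2 | max |layerFn (k + 3) v - layerFn (k + 3) x| (n k - 2 - layerFn (k + 2) v - (n k - 2 - layerFn (k + 2) x)) = 2 * m}) * (bondPercolation (zdGraph 2) half).real R ≤ (bondPercolation (zdGraph 2) half).real (openCrossing {v : Site 2 | 0 ≤ n k - 2 - layerFn (k + 2) v ∧ max |layerFn (k + 3) v - layerFn (k + 3) x| (n k - 2 - layerFn (k + 2) v - (n k - 2 - layerFn (k + 2) x)) ≤ 2 * m} {x} {v : Site 2 | max |layerFn (k + 3) v - layerFn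 (k + 3) x| (n k - 2 - layerFn (k + 2) v - (n k - 2 - layerFn (k + 2) x)) = 2 * m} ∩ (openCrossing {v : Site 2 | layerFn (k + 3) x + m ≤ layerFn (k + 3) v ∧ layerFn (k + 3) v ≤ layerFn (k + 3) x + 2 * m ∧ 0 ≤ n k - 2 - layerFn (k + 2) v ∧ n k - 2 - layerFn (k + 2) v ≤ n k - 2 - layerFn (k + 2) x + 2 * m} {v : Site 2 | n k - 2 - layerFn (k + 2) v = 0} {v : Site 2 | n k - 2 - layerFn (k + 2) v = n k - 2 - layerFn (k + 2) x + 2 * m} ∩ openCrossing {v : Site 2 | layerFn (k + 3) x - 2 * m ≤ layerFn (k + 3) v ∧ layerFn (k + 3) v ≤ layerFn (k + 3) x + 2 * m ∧ n k - 2 - layerFn (k + 2) x + m ≤ n k - 2 - layerFn (k + 2) v ∧ n k - 2 - layerFn (k + 2) v ≤ n k - 2 - layerFn (k + 2) x + 2 * m} {v : Site 2 | layerFn (k + 3) v = layerFn (k + 3) x - 2 * m} {v : Site 2 | layerFn (k + 3) v = layerFn (k + 3) x + 2 * m} ∩ openCrossing {v : Site 2 | layerFn (k + 3) x - 2 * m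 ≤ layerFn (k + 3) v ∧ layerFn (k + 3) v ≤ layerFn (k + 3) x - m ∧ 0 ≤ n k - 2 - layerFn (k + 2) v ∧ n k - 2 - layerFn (k + 2) v ≤ n k - 2 - layerFn (k + 2) x + 2 * m} {v : Site 2 | n k - 2 - layerFn (k + 2) v = 0} {v : Site 2 | n k - 2 - layerFn (k + 2) v = n k - 2 - layerFn (k + 2) x + 2 * m}) ∩ openCrossing {v : Site 2 | layerFn (k + 3) x - m ≤ layerFn (k + 3) v ∧ layerFn (k + 3) v ≤ layerFn (k + 3) x + m ∧ 0 ≤ n k - 2 - layerFn (k + 2) v ∧ n k - 2 - layerFn (k + 2) v ≤ 3 * m} {v : Site 2 | n k - 2 - layerFn (k + 2) v = 0} {v : Site 2 | n k - 2 - layerFn (k + 2) v = 3 * m} ∩ R) :=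
  real_site_glue_ge

end Summit.CriticalPhenomena.CardyFormulaZ2.Cruxes.ParafermionToSLESixFamilies.PotentialDarbouxPicardDiamond

end
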